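import Summits.BirchSwinnertonDyer.BirchSwinnertonDyer.Theorems.GenusKolyvaginAtTwoMinimalTwinBSDTwoTwinShaAnnihilationSignFree
import Summits.BirchSwinnertonDyer.BirchSwinnertonDyer.Theorems.GenusKolyvaginAtTwoMinimalTwinBSDTwoHeegnerIndexUpperOddCut
import Summits.BirchSwinnertonDyer.BirchSwinnertonDyer.Theorems.GenusKolyvaginAtTwoShaCardDvdPowAtTwoPosTOnCut
import HarnessLib

/-!
# Route `GenusKolyvaginAtTwo`, crux U₂ `MinimalTwinBSDTwo` (stmt-BirchSwinnertonDyer-22985), LINE 23 «twin_swap» v2.5, stub DIV′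
# `HeegnerIndexUpperAnyTwinAtTwo` ON THE ODD CUT, EITHER SIGN OF `Δ`: **`#Ш(W_K)[2^∞] ∣ 4^{M₀}` for the rank-ONE Heegner member at every exact
# depth `M₀` of `P(1)`, inside the genus budget `(Δ < 0 ∧ ord₂ C(Wd) ≤ 1) ∨ ord₂ C(Wd) = 0`, modulo Q2** — the `Δ > 0` (all-silent) frames added

Seat `bsd-line-gk2-p2` g31 (PROVER seat 2/3, cell `bsd-f1-sign2`, LINE 23 holder), `--supports stmt-BirchSwinnertonDyer-22985 --as helper`.
THEOREMS ONLY (no definition, no named fact, no `sorry`).  BSD is NOT proved by any of this; neither is U₂, nor DIV′ as registered (budget `≥ 2`,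
the Manin/Tamagawa factor on even cells), nor NDIV′.

Sequel of this seat's `…MinimalTwinBSDTwoHeegnerIndexUpperOddCut` (p809727, `Δ < 0`) with the engine replaced by its SIGN-FREE form
`…MinimalTwinBSDTwoTwinShaAnnihilationSignFree` (B2Q⁻±: Kolyvagin's Theorem B₂ at `2` over `ℚ` for the twin of the `ε = −1` member at a REGULAR
Kolyvagin prime, any sign of `Δ`), so that the `Δ > 0` frames of LINE 23 — the ALL-SILENT twins, `ord₂ C(Wd) = 0`, where the single changed local
condition is the real place — are covered too.  Three further simplifications over p809727: (i) `rank W^{(d_K)}(ℚ) = 0` now comes from the engine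
itself by Kummer (gk2-p3 g27 `mordellWeilRank_eq_zero_of_two_pow_smul_selmer_eq_zero`), not from the habitat rank law; (ii) `Ш(W^{(d_K)}/ℚ)[2^∞]` is
finite because it has finite exponent (`finite_primaryComponent_sha_rat_two_of_exponent`); (iii) the `2`-rank input on `Δ > 0` is gk2-p3 g27's
Mazur–Rubin dichotomy at the real `T`-place (`natCard_selmerGroup_twin_shift_of_posDisc_of_padicValNat_eq_zero`).

* §1 (RANKQ⁻±) `natCard_selmerGroup_twin_two_dvd_four_of_budget` — `#Sel₂(W) = 2 ⟹ #Sel₂(Wd) ∣ 4` inside the budget, either sign (UNCONDITIONAL);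
* §2 `finite_and_natCard_primaryComponent_sha_baseChange_two_dvd_pow_of_swappedPair_signFree` — **`#Ш(W_K)[2^∞] ∣ 2^{2M₀}`** on the frame
  (habitat + `w(W) = −1` + `rank W(ℚ) ≥ 1` + `#Sel₂(W) = 2` + budget), modulo Q2 — g23's two-branch swapped sandwich with a twin of `Ш`-exponent `2^{M₀}`;
* §3 `heegnerIndexUpper_conclusion_onOddCut_signFree` — DIV′'s conclusion VERBATIM on DIV′'s binders + the cut (no sign of `Δ`), mod Q2 + GZK;
* §4 `heegnerIndexUpper_conclusion_onOddCut_allSilent` — the same at every ALL-SILENT frame (budget `0` automatic, gk2-p3 g27).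

CENSUS READING.  The UPPER half DIV′ of LINE 23 is now a kernel theorem, modulo Q2 (+ GZK for `rank W(ℚ) ≥ 1`), on the whole odd habitat cut inside
the genus budget: `Δ < 0` with one transposition prime (p809727) and ANY sign with an all-silent `d_K` (this file).  Still outside: budget `≥ 2`, even `c`
or even `C(W)` (Manin/Tamagawa factor), and NDIV′ (Kolyvagin's conjecture at `2`).  Placement: Kolyvagin 1989 Thm. B_l (`l = 2`, `A = E^D`) + Kramer 1981 /
Gross 1991 §5 + Mazur–Rubin 2010 Cor. 3.4 (i): COROLLARY-OF-PRINT assembled in the kernel; beyond-print theorem: no.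

References: [Kolyvagin1989Izv] Thm. B_l; [McCallumLMS1991] §5 Thm. 5.4, Cor. 5.6; [Kramer1981] Thm. 1, §2 Props. 3, 6; [GrossLMS1991] §5 (5.1)–(5.3);
[MazurRubin2010] Prop. 3.3, Cor. 3.4 (i); [SilvermanAEC2009] VIII.2, X.4.2, X.4.14, X.5 Cor. 5.4.
-/

set_option autoImplicit false
set_option linter.dupNamespace false -- `Summit.<P>.<Sub>` repeats `BirchSwinnertonDyer` (D-0017)

noncomputable section

open scoped Classical

namespace Summit.BirchSwinnertonDyer.BirchSwinnertonDyer.Theorems.GenusExact.TwinSwap.TwinAnnihilation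

open Literature.NumberTheory.EllipticCurves Literature.NumberTheory.GaloisRepresentations WeierstrassCurve NumberField
  IsDedekindDomain Field AddSubgroup Literature.NumberTheory.EllipticCurves.ModularForms
open Summit.BirchSwinnertonDyer.Rank1Residual Literature.Barriers.BirchSwinnertonDyer
open Summit.BirchSwinnertonDyer.BirchSwinnertonDyer.Theses.GenusKolyvaginAtTwo (KolyvaginRelationAtTwo)
open Summit.BirchSwinnertonDyer.BirchSwinnertonDyer.Theorems.GenusExact.PlusDescent
open Summit.BirchSwinnertonDyer.BirchSwinnertonDyer.Theorems.GenusExact.RegularPlusDescent (archimedeanBit_sha_comap_resBaseChange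
  relIndex_sha_comap_resBaseChange_le_of_arch relIndex_sha_comap_resBaseChange_twin_le_two_pow_succ_of_arch)

/-! ## §1 (RANKQ⁻±) `#Sel₂(W) = 2 ⟹ #Sel₂(W^{(d_K)}) ∣ 4` inside the genus budget, either sign of `Δ` -/

/-- **(RANKQ⁻±): `#Sel₂(W) = 2 ⟹ #Sel₂(Wd) ∣ 4`** for `W/ℚ` globally minimal with `C(W)` odd, `K` imaginary quadratic with odd `d_K`, Heegner for `N_W`, an
elliptic model `Wd ≅ W^{(d_K)}`, inside the genus budget `(Δ_W < 0 ∧ ord₂ C(Wd) ≤ 1) ∨ ord₂ C(Wd) = 0`: the `Δ < 0` branch is this seat's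
`natCard_selmerGroup_twin_two_dvd_four_of_genusBudget_le_one` (one transposition prime, MR Cor. 3.4 (i)); the budget-`0` branch forces `Δ_W > 0`
(genus parity: on `Δ < 0` the bit count `ord₂ C(Wd)` is odd) and is gk2-p3 g27's Mazur–Rubin dichotomy at the real `T`-place
`natCard_selmerGroup_twin_shift_of_posDisc_of_padicValNat_eq_zero` (`#Sel₂(Wd)·2 = #Sel₂(W)` or `#Sel₂(Wd) = #Sel₂(W)·2`).  UNCONDITIONAL.
[cite: MazurRubin2010, Cor. 3.4 (i)] [cite: Kramer1981, §2 Props. 3, 6, Thm. 1] -/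
theorem natCard_selmerGroup_twin_two_dvd_four_of_budget (W : WeierstrassCurve ℚ) [W.IsElliptic] [W.IsGloballyMinimal]
    {K : Type} [Field K] [NumberField K]
    (hTam : Odd W.tamagawaProduct) (hK : IsImaginaryQuadratic K) (hodd : Odd (NumberField.discr K))
    (hH : SatisfiesHeegnerHypothesis (W.conductorNorm ℤ) K)
    (Wd : WeierstrassCurve ℚ) [Wd.IsElliptic] (hWd : ∃ C : VariableChange ℚ, C • W.quadraticTwist (NumberField.discr K : ℚ) = Wd)
    (hbudget : (W.Δ < 0 ∧ padicValNat 2 Wd.tamagawaProduct ≤ 1) ∨ padicValNat 2 Wd.tamagawaProduct = 0)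
    (hSel : Nat.card (W.selmerGroup 2) = 2) :
    Nat.card (Wd.selmerGroup 2) ∣ 4 := by
  rcases hbudget with ⟨hneg, hle⟩ | hDEF
  · exact natCard_selmerGroup_twin_two_dvd_four_of_genusBudget_le_one W hneg hTam hK hodd hH Wd hWd hle hSel
  · obtain ⟨Cd, hCd⟩ := hWd
    have hpos : 0 < W.Δ := by
      rcases lt_trichotomy W.Δ 0 with hneg | h0 | hpos
      · obtain ⟨k, hk⟩ := odd_padicValNat_two_tamagawaProduct_twin_of_Δ_neg W hK hodd hH hTam hneg Cd hCd
        omega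
      · exact absurd h0 W.isUnit_Δ.ne_zero
      · exact hpos
    have h := natCard_selmerGroup_twin_shift_of_posDisc_of_padicValNat_eq_zero W hpos hTam hK hodd hH Wd ⟨Cd, hCd⟩ hDEF
    rw [hSel] at h
    rcases h with h | h
    · exact ⟨4, by omega⟩
    · exact ⟨1, by omega⟩

/-! ## §2 The swapped pair sandwich WITH EXPONENT, sign-free: `#Ш(W_K)[2^∞] ∣ 4^{M₀}` inside the genus budget -/

/-- **THE SWAPPED PAIR SANDWICH WITH EXPONENT, SIGN-FREE: `#Ш(W_K)[2^∞] ∣ 4^{M₀}`.**  Frame: `W/ℚ` globally minimal, non-CM, `C(W)` odd, an odd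
prime `v` of multiplicative reduction, ANY sign of `Δ_W`, `ρ_{W,2^n}` onto for all `n ≥ 1`; `K` imaginary quadratic, `d_K` odd
`≠ −3`, Heegner for `N_W`, `d_K·(−|Δ|)`, `d_K·(−2|Δ|)` non-squares; `(Dt, β, ι)`, a conductor-`1` datum `d₁` with `2^{M₀+1} ∤ P(1)` in `W(K[1])`;
`w(W) = −1`; `rank W(ℚ) ≥ 1` and `#Sel₂(W) = 2`; an elliptic model `Wd = Cd • W^{(d_K)}` inside the genus budget `(Δ_W < 0 ∧ ord₂ C(Wd) ≤ 1) ∨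
ord₂ C(Wd) = 0`.  Then `Ш(W_K)[2^∞]` is finite and **`#Ш(W_K)[2^∞] ∣ 2^{2M₀}`**.  Proof = g23's two-branch
`finite_and_natCard_primaryComponent_sha_baseChange_two_eq_one_of_swappedPair` with the base `T₀ = W^{(d_K)}` now of `Ш`-exponent `2^{M₀}` ((B2Q⁻±)
`two_pow_M0_smul_eq_zero_of_mem_sha_twist_rat_signFree`) — hence `Ш(T₀/ℚ)[2^∞]` finite (`finite_primaryComponent_sha_rat_two_of_exponent`) and
`rank T₀(ℚ) = 0` by Kummer (gk2-p3 g27 `mordellWeilRank_eq_zero_of_two_pow_smul_selmer_eq_zero`, no GZK, no habitat rank law) — and `2`-rank `≤ 2`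
((RANKQ⁻±) §1); then gk2-p3 g27's sign-free closer and the twist transport `Ψ`.  Modulo Q2 only.
[cite: Kolyvagin1989Izv, Thm. B_l] [cite: McCallumLMS1991, §5 Thm. 5.4, Cor. 5.6] [cite: Kramer1981, Thm. 1] [cite: GrossLMS1991, §5 (5.1)–(5.3)]
[cite: MazurRubin2010, Cor. 3.4 (i)] [cite: SilvermanAEC2009, X.4.14, X.5 Cor. 5.4] -/
theorem finite_and_natCard_primaryComponent_sha_baseChange_two_dvd_pow_of_swappedPair_signFree (hQ2 : KolyvaginRelationAtTwo)
    (W : WeierstrassCurve ℚ) [W.IsElliptic] [W.IsGloballyMinimal] [NeZero (W.conductorNorm ℤ)] (hcm : ¬ W.HasCM)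
    (hT : Odd W.tamagawaProduct) (v : HeightOneSpectrum (𝓞 ℚ)) (h2v : ((2 : ℕ) : 𝓞 ℚ) ∉ v.asIdeal)
    (hNv : ((W.conductorNorm ℤ : ℕ) : 𝓞 ℚ) ∈ v.asIdeal) (hmult : W.HasMultiplicativeReductionAt v)
    (K : Type) [Field K] [NumberField K] (hIQ : IsImaginaryQuadratic K) (hodd : Odd (NumberField.discr K))
    (h3 : NumberField.discr K ≠ -3) (hHe : SatisfiesHeegnerHypothesis (W.conductorNorm ℤ) K)
    (hsq1 : ¬ IsSquare ((NumberField.discr K : ℚ) * -|W.Δ|)) (hsq2 : ¬ IsSquare ((NumberField.discr K : ℚ) * (-(2 * |W.Δ|))))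
    (hρ : ∀ n : ℕ, 0 < n → W.HasSurjectiveModNGaloisRep ((2 : ℤ) ^ n))
    (Dt : ModularParametrizationData W (W.conductorNorm ℤ)) (β : ℤ) (ι : K →+* ℂ) (d₁ : KolyvaginHeegnerData Dt β ι 1) (M₀ : ℕ)
    (hndiv : ¬ ∃ Q : (W.baseChange (ringClassField K ι 1)).toAffine.Point, ((2 ^ (M₀ + 1) : ℕ) : ℤ) • Q = d₁.derivedPoint)
    (hw : W.rootNumber = -1) (hrk : 1 ≤ W.mordellWeilRank) (hSel : Nat.card (W.selmerGroup 2) = 2)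
    {Wd : WeierstrassCurve ℚ} [Wd.IsElliptic] (Cd : VariableChange ℚ) (hWd : Cd • W.quadraticTwist (NumberField.discr K : ℚ) = Wd)
    (hbudget : (W.Δ < 0 ∧ padicValNat 2 Wd.tamagawaProduct ≤ 1) ∨ padicValNat 2 Wd.tamagawaProduct = 0) :
    Finite (AddCommGroup.primaryComponent (↥(W.baseChange K).sha) 2) ∧
      Nat.card (AddCommGroup.primaryComponent (↥(W.baseChange K).sha) 2) ∣ 2 ^ (2 * M₀) := by
  haveI : Fact (Nat.Prime 2) := ⟨Nat.prime_two⟩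
  haveI : NeZero (2 : ℚ) := ⟨two_ne_zero⟩
  have h2 : Module.finrank ℚ K = 2 := hIQ.1
  have hdK : (NumberField.discr K : ℚ) ≠ 0 := by exact_mod_cast NumberField.discr_ne_zero K
  haveI hT₀ell : (W.quadraticTwist (NumberField.discr K : ℚ)).IsElliptic := W.isElliptic_quadraticTwist hdK
  haveI hX'ell : ((W.quadraticTwist (NumberField.discr K : ℚ)).quadraticTwist (NumberField.discr K : ℚ)).IsElliptic :=
    (W.quadraticTwist (NumberField.discr K : ℚ)).isElliptic_quadraticTwist hdK
  haveI hT₀Kell : ((W.quadraticTwist (NumberField.discr K : ℚ)).baseChange K).IsElliptic :=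
    inferInstanceAs (((W.quadraticTwist (NumberField.discr K : ℚ)).map (algebraMap ℚ K)).IsElliptic)
  haveI hEKell : (W.baseChange K).IsElliptic := inferInstanceAs ((W.map (algebraMap ℚ K)).IsElliptic)
  -- `X' = T₀^(d_K) = D • W`, `Aut(K/ℚ) = {1, τ}`, `θ = √d_K`
  obtain ⟨D, hD⟩ := exists_quadraticTwist_quadraticTwist_eq_smul W hdK
  obtain ⟨τ, θ, hτ1, hθQ, hθ2, hτθ, -⟩ := exists_gal_ne_one_sqrt_discr K h2
  -- ### (a) the rank-one member: `rank W(ℚ) = 1`, a rational point of infinite order, `#Sel₂(X') = 2`, `Ш(X'/ℚ)[2^∞] = 0`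
  obtain ⟨hrkW1, -, -⟩ := rank_eq_one_and_sha_primary_eq_zero_of_natCard_selmerGroup_eq_two W hSel hrk
  obtain ⟨Q, hQ⟩ := exists_not_isOfFinAddOrder_of_one_le_mordellWeilRank W hrk
  have hSelX : Nat.card (((W.quadraticTwist (NumberField.discr K : ℚ)).quadraticTwist (NumberField.discr K : ℚ)).selmerGroup 2) = 2 := by
    have h := natCard_selmerGroup_smul W D (n := 2) two_ne_zero
    simp only [Nat.cast_ofNat] at h
    rw [← hD] at h
    exact h.trans hSel
  have hrkX : ((W.quadraticTwist (NumberField.discr K : ℚ)).quadraticTwist (NumberField.discr K : ℚ)).mordellWeilRank = 1 := by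
    have h : (D • W).mordellWeilRank = W.mordellWeilRank := mordellWeilRank_variableChange_holds W D
    rw [← hD] at h
    rw [h, hrkW1]
  obtain ⟨-, -, hT0⟩ := rank_eq_one_and_sha_primary_eq_zero_of_natCard_selmerGroup_eq_two
    ((W.quadraticTwist (NumberField.discr K : ℚ)).quadraticTwist (NumberField.discr K : ℚ)) hSelX (by rw [hrkX])
  -- ### (b) the base `T₀`: `Ш`-exponent `2^{M₀}` (B2Q⁻±), hence `Ш(T₀/ℚ)[2^∞]` finite; rank `0` by Kummer (`2^{M₀} · Sel_(2^{M₀+1})(T₀) = 0`)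
  have hB2Q : ∀ (k : ℕ) (a : (W.quadraticTwist (NumberField.discr K : ℚ)).galH1), a ∈ (W.quadraticTwist (NumberField.discr K : ℚ)).sha →
      ((2 ^ k : ℕ) : ℤ) • a = 0 → ((2 ^ M₀ : ℕ) : ℤ) • a = 0 := fun k a ha hka ↦
    two_pow_M0_smul_eq_zero_of_mem_sha_twist_rat_signFree hQ2 W hcm hT v h2v hNv hmult K hIQ hodd h3 hHe hsq1 hsq2 hρ Dt β ι d₁ M₀ hndiv hw
      k a ha hka
  have hexp : ∀ a ∈ AddCommGroup.primaryComponent (↥(W.quadraticTwist (NumberField.discr K : ℚ)).sha) 2, 2 ^ M₀ • a = 0 :=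
    forall_primaryComponent_sha_two_pow_smul_eq_zero_of_galH1 (W.quadraticTwist (NumberField.discr K : ℚ)) hB2Q
  haveI hfinT : Finite (AddCommGroup.primaryComponent (↥(W.quadraticTwist (NumberField.discr K : ℚ)).sha) 2) :=
    finite_primaryComponent_sha_rat_two_of_exponent (W.quadraticTwist (NumberField.discr K : ℚ)) hexp
  have hrkT0 : (W.quadraticTwist (NumberField.discr K : ℚ)).mordellWeilRank = 0 :=
    mordellWeilRank_eq_zero_of_two_pow_smul_selmer_eq_zero (W.quadraticTwist (NumberField.discr K : ℚ)) fun s hs ↦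
      two_pow_smul_selmer_twist_rat_eq_zero_signFree hQ2 W hcm hT v h2v hNv hmult K hIQ hodd h3 hHe hsq1 hsq2 hρ Dt β ι d₁ M₀ hndiv hw
        (M₀ + 1) s hs
  -- `E(K)[2] = 0` from `ρ̄_{E,2}` onto
  have hs2 : W.HasSurjectiveModNGaloisRep 2 := by simpa using hρ 1 one_pos
  have h2K : ∀ P : (W.baseChange K).toAffine.Point, (2 : ℤ) • P = 0 → P = 0 := fun P hP ↦
    EigenClassesFinite.forall_zsmul_two_pow_baseChange_eq_zero_of_hasSurjectiveModNGaloisRep_two W K h2 hs2 1 P (by simpa using hP)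
  -- ### (c) the frame of `T₀ ⊗ K`: no `2`-torsion, rank `≤ 1`, the anti-invariant point of infinite order
  have hrkTK : ((W.quadraticTwist (NumberField.discr K : ℚ)).baseChange K).mordellWeilRank ≤ 1 := by
    haveI : Module.Finite ℤ ((W.quadraticTwist (NumberField.discr K : ℚ)).baseChange K).toAffine.Point :=
      ((W.quadraticTwist (NumberField.discr K : ℚ)).baseChange K).module_finite_point_holds
    rw [(W.quadraticTwist (NumberField.discr K : ℚ)).mordellWeilRank_baseChange_of_finrank_eq_two_of_finite K h2, hrkT0, hrkX]
  obtain ⟨C₁, hC₁⟩ := W.exists_variableChange_quadraticTwist_one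
  have h2torsT : ∀ P : ((W.quadraticTwist (NumberField.discr K : ℚ)).baseChange K).toAffine.Point, (2 : ℤ) • P = 0 → P = 0 := by
    intro P hP
    let eK : ((W.quadraticTwist (NumberField.discr K : ℚ)).baseChange K).toAffine.Point ≃+ (W.baseChange K).toAffine.Point :=
      ((VariableChange.pointEquiv ((W.quadraticTwist (NumberField.discr K : ℚ)).baseChange K) (twistUntwist hθQ)).trans
        (Affine.Point.congrEquiv (twistUntwist_smul_baseChange W hθQ hθ2))).trans
        ((Affine.Point.congrEquiv (congrArg (fun V : WeierstrassCurve ℚ ↦ V.baseChange K) hC₁.symm)).trans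
          (VariableChange.pointEquivBaseChange W C₁ K).symm)
    have h := h2K (eK P) (by rw [← map_zsmul, hP, map_zero])
    exact eK.injective (h.trans (map_zero eK).symm)
  -- the frame point: the twist of `Q`, anti-invariant of infinite order
  have hτθ' : (τ : K →ₐ[ℚ] K) θ = -θ := hτθ
  obtain ⟨y, hy_inf, hyanti⟩ := exists_antiInvariant_twist_point_of_not_isOfFinAddOrder W hθQ hθ2 hdK hτθ' hQ
  have hanti : IsOfFinAddOrder (Affine.Point.map (W' := W.quadraticTwist (NumberField.discr K : ℚ)) (τ : K →ₐ[ℚ] K) y + y) := by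
    rw [hyanti, neg_add_cancel]
    exact IsOfFinAddOrder.zero
  haveI : Module.Finite ℤ ((W.quadraticTwist (NumberField.discr K : ℚ)).baseChange K).toAffine.Point :=
    ((W.quadraticTwist (NumberField.discr K : ℚ)).baseChange K).module_finite_point_holds
  obtain ⟨M, -, hndiv'⟩ := exists_pow_smul_eq_and_not_of_not_isOfFinAddOrder Nat.prime_two hy_inf
  have hndiv : ∀ Q' : ((W.quadraticTwist (NumberField.discr K : ℚ)).baseChange K).toAffine.Point, ((2 ^ (M + 1) : ℕ) : ℤ) • Q' ≠ y :=
    fun Q' h ↦ hndiv' ⟨Q', h⟩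
  -- ### (d) the two budgets: twin side for `T₀` (the route's), model-free core for `X' = D • W`
  have hgoodX : ∀ p : ℕ, p.Prime → ¬ (p : ℤ) ∣ NumberField.discr K → ((Ideal.span {(p : ℤ)}).primesOver (𝓞 K)).ncard ≠ 2 →
      ((W.quadraticTwist (NumberField.discr K : ℚ)).quadraticTwist (NumberField.discr K : ℚ)).HasGoodReductionAt (Matsuno2009.primePlace p) := by
    intro p hp _ hns
    rw [hD]
    exact (hasGoodReductionAt_smul_iff_holds (Matsuno2009.primePlace p) W D).mpr
      (hasGoodReductionAt_primePlace_of_ncard_ne_two W K hHe hp hns)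
  have hprodX : ∏ p ∈ (NumberField.discr K).natAbs.primeFactors,
      Nat.card {P : (((W.quadraticTwist (NumberField.discr K : ℚ)).quadraticTwist (NumberField.discr K : ℚ)).baseChange
        ((Matsuno2009.primePlace p).adicCompletion ℚ)).toAffine.Point // 2 • P = 0} = 2 ^ padicValNat 2 Wd.tamagawaProduct := by
    rw [← prod_ncard_roots_add_one_eq_two_pow_padicValNat_tamagawaProduct_twin W hIQ hodd hHe hT Cd hWd]
    refine Finset.prod_congr rfl fun p hp ↦ ?_
    obtain ⟨hpr, hpdvd, -⟩ := Nat.mem_primeFactors.mp hp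
    have hpd : (p : ℤ) ∣ NumberField.discr K := Int.natCast_dvd.mpr hpdvd
    have hp2 : p ≠ 2 := by
      rintro rfl
      obtain ⟨r, hr⟩ := hodd
      omega
    haveI := Fact.mk hpr
    rw [natCard_twoTorsion_baseChange_eq_of_smul D hD ((Matsuno2009.primePlace p).adicCompletion ℚ),
      natCard_twoTorsion_adicCompletion_eq_padic W (Matsuno2009.primePlace p) (Matsuno2009.natCast_mem_primePlace hpr)]
    exact GenusKolyTwin.natCard_twoTorsion_padic_eq W hp2
      (not_dvd_minimalDiscriminantInt_of_dvd_discr_of_heegner W K hIQ.1 hHe hpr hp2 hpd)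
  have heqT : padicValNat 2 (W.quadraticTwist (NumberField.discr K : ℚ)).tamagawaProduct = padicValNat 2 Wd.tamagawaProduct := by
    have h1 := prod_ncard_roots_add_one_eq_two_pow_padicValNat_tamagawaProduct_twin W hIQ hodd hHe hT
      (Wd := W.quadraticTwist (NumberField.discr K : ℚ)) 1 (one_smul _ _)
    have h2' := prod_ncard_roots_add_one_eq_two_pow_padicValNat_tamagawaProduct_twin W hIQ hodd hHe hT Cd hWd
    exact Nat.pow_right_injective le_rfl (h1.symm.trans h2')
  -- (RANKQ⁻±) for the base: `#Sel₂(T₀) ∣ 4`, hence `#Ш(T₀/ℚ)[2] ≤ 4`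
  have hSelT : Nat.card ((W.quadraticTwist (NumberField.discr K : ℚ)).selmerGroup 2) ∣ 4 :=
    natCard_selmerGroup_twin_two_dvd_four_of_budget W hT hIQ hodd hHe (W.quadraticTwist (NumberField.discr K : ℚ))
      ⟨1, one_smul _ _⟩ (by rw [heqT]; exact hbudget) hSel
  have h4 : Nat.card (AddSubgroup.torsionBy (↥(W.quadraticTwist (NumberField.discr K : ℚ)).sha) ((2 : ℕ) : ℤ)) ≤ 4 := by
    have hsha := natCard_sha_torsionBy_dvd_natCard_selmerGroup (W.quadraticTwist (NumberField.discr K : ℚ)) (n := 2) two_ne_zero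
    exact Nat.le_of_dvd (by norm_num) (hsha.trans hSelT)
  have hbud :
      ((W.quadraticTwist (NumberField.discr K : ℚ)).sha).relIndex
          ((((W.quadraticTwist (NumberField.discr K : ℚ)).baseChange K).sha).comap
            (resBaseChange (W.quadraticTwist (NumberField.discr K : ℚ)) K)) ≠ 0 ∧
      (((W.quadraticTwist (NumberField.discr K : ℚ)).quadraticTwist (NumberField.discr K : ℚ)).sha).relIndex
          (((((W.quadraticTwist (NumberField.discr K : ℚ)).quadraticTwist (NumberField.discr K : ℚ)).baseChange K).sha).comap
            (resBaseChange ((W.quadraticTwist (NumberField.discr K : ℚ)).quadraticTwist (NumberField.discr K : ℚ)) K)) ≠ 0 ∧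
      ((W.quadraticTwist (NumberField.discr K : ℚ)).sha).relIndex
          ((((W.quadraticTwist (NumberField.discr K : ℚ)).baseChange K).sha).comap
            (resBaseChange (W.quadraticTwist (NumberField.discr K : ℚ)) K)) *
        (((W.quadraticTwist (NumberField.discr K : ℚ)).quadraticTwist (NumberField.discr K : ℚ)).sha).relIndex
          (((((W.quadraticTwist (NumberField.discr K : ℚ)).quadraticTwist (NumberField.discr K : ℚ)).baseChange K).sha).comap
            (resBaseChange ((W.quadraticTwist (NumberField.discr K : ℚ)).quadraticTwist (NumberField.discr K : ℚ)) K)) ≤ 4 := by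
    rcases hbudget with ⟨hneg, hDEF⟩ | hDEF
    · -- `Δ < 0`, `ord₂ C(Wd) ≤ 1`
      obtain ⟨hneT, hleT⟩ := relIndex_sha_comap_resBaseChange_twin_le_two_pow W (K := K) hneg hIQ hodd hHe hT
        (Wd := W.quadraticTwist (NumberField.discr K : ℚ)) 1 (one_smul _ _)
      rw [heqT] at hleT
      have hneX := relIndex_sha_relaxed_ne_zero ((W.quadraticTwist (NumberField.discr K : ℚ)).quadraticTwist (NumberField.discr K : ℚ))
        K h2 hodd hgoodX
      have hleX := relIndex_sha_relaxed_le_prod_natCard_twoTorsion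
        ((W.quadraticTwist (NumberField.discr K : ℚ)).quadraticTwist (NumberField.discr K : ℚ)) K h2 hodd hgoodX
      have hΔX : ((W.quadraticTwist (NumberField.discr K : ℚ)).quadraticTwist (NumberField.discr K : ℚ)).Δ < 0 := by
        rw [hD, variableChange_Δ]
        have h1 : (0 : ℚ) < ((D.u⁻¹ : ℚˣ) : ℚ) ^ 12 := Even.pow_pos (by norm_num) (Units.ne_zero _)
        nlinarith [mul_pos h1 (neg_pos.mpr hneg)]
      rw [comap_resBaseChange_sha_inf_iInf_eq_of_Δ_neg _ K hΔX] at hneX hleX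
      rw [hprodX] at hleX
      refine ⟨hneT, hneX, ?_⟩
      have h22 : 2 ^ padicValNat 2 Wd.tamagawaProduct ≤ 2 :=
        calc 2 ^ padicValNat 2 Wd.tamagawaProduct ≤ 2 ^ 1 := Nat.pow_le_pow_right (by norm_num) hDEF
          _ = 2 := pow_one 2
      calc _ ≤ 2 ^ padicValNat 2 Wd.tamagawaProduct * 2 ^ padicValNat 2 Wd.tamagawaProduct := Nat.mul_le_mul hleT hleX
        _ ≤ 2 * 2 := Nat.mul_le_mul h22 h22
    · -- any sign, `ord₂ C(Wd) = 0`: the archimedean bit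
      obtain ⟨hneT, hleT⟩ := relIndex_sha_comap_resBaseChange_twin_le_two_pow_succ_of_arch W K hIQ hodd hHe hT
        (Wd := W.quadraticTwist (NumberField.discr K : ℚ)) 1 (one_smul _ _)
        (archimedeanBit_sha_comap_resBaseChange (W.quadraticTwist (NumberField.discr K : ℚ)) K)
      rw [heqT, hDEF, zero_add, pow_one] at hleT
      obtain ⟨hneX, hleX⟩ := relIndex_sha_comap_resBaseChange_le_of_arch K
        ((W.quadraticTwist (NumberField.discr K : ℚ)).quadraticTwist (NumberField.discr K : ℚ)) h2 hodd hgoodX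
        (archimedeanBit_sha_comap_resBaseChange _ K)
      rw [hprodX, hDEF, pow_zero, mul_one] at hleX
      exact ⟨hneT, hneX, Nat.mul_le_mul hleT hleX⟩
  obtain ⟨hne, hneT', hbud4⟩ := hbud
  -- ### (e) the sandwich for the base `T₀`: `#Ш(T₀/K)[2^∞] ∣ 4^{M₀}`
  obtain ⟨hfinTK, hdvd⟩ := natCard_sha_dvd_pow_of_pair_of_frame (W.quadraticTwist (NumberField.discr K : ℚ)) K hIQ hτ1 h2torsT
    hrkTK y M hndiv hanti hT0 hne hneT' hbud4 hexp h4
  -- ### (f) transport along `Ψ : H¹(K, T₀) ≃ H¹(K, E)`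
  haveI := hfinTK
  obtain ⟨Ψ, hΨ, -, -, -⟩ := exists_galH1_twistTransport W K h2 hθQ hθ2 τ hτ1
  obtain ⟨hfin, hcard⟩ := finite_and_natCard_primaryComponent_eq_of_addEquiv Ψ
    (((W.quadraticTwist (NumberField.discr K : ℚ)).baseChange K).sha) ((W.baseChange K).sha) hΨ 2
  refine ⟨hfin, ?_⟩
  rw [hcard]
  exact hdvd


/-! ## §3 DIV′'s conclusion verbatim on the odd cut, either sign of `Δ` -/

/-- **DIV′ ON THE ODD CUT, EITHER SIGN OF `Δ` (LINE 23 v2.5 stub `stub_heegnerIndexUpper`, conclusion VERBATIM):** on the binders of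
`TwinSwapV25.HeegnerIndexUpperAnyTwinAtTwo` PLUS the cut — `C(W)` odd, an odd prime `v` of multiplicative reduction, `ρ_{W,2^n}` onto (`n ≥ 1`),
`w(W) = −1`, `Dt.c` odd, and the genus budget `(Δ_W < 0 ∧ ord₂ C(Wd) ≤ 1) ∨ ord₂ C(Wd) = 0` (on `Δ > 0`: the all-silent frames) — and the two named
route inputs Q2 (`KolyvaginRelationAtTwo`, item 24880) and GZK (`rank_eq_analyticRank_of_analyticRank_le_one`, item 19921; only for `rank W(ℚ) ≥ 1`):
**`#Ш(W_K)[2^∞] · 2^{2(ord₂ c + ord₂ C(W))} ∣ 2^{2M₀}`**.  The two Theorem-B field exclusions are automatic (gk2-p2 g7); DIV′'s analytic binders are idle.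
CONDITIONAL on Q2 and GZK; closes nothing; BSD is NOT proved.  With this seat's `heegnerIndexUpper_conclusion_onOddNegCut` (Δ < 0) the upper half of
LINE 23 is a kernel theorem on the WHOLE odd habitat cut inside the genus budget, both signs of `Δ`.
[cite: Kolyvagin1989Izv, Thm. B_l] [cite: McCallumLMS1991, §5 Cor. 5.6] [cite: Kramer1981, Thm. 1] [cite: MazurRubin2010, Cor. 3.4 (i)] -/
theorem heegnerIndexUpper_conclusion_onOddCut_signFree (hQ2 : KolyvaginRelationAtTwo) (hGZK : rank_eq_analyticRank_of_analyticRank_le_one)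
    (W : WeierstrassCurve ℚ) [W.IsElliptic] [W.IsGloballyMinimal] [NeZero (W.conductorNorm ℤ)]
    (hcm : ¬ W.HasCM) (hr : W.analyticRank = 1) (hSel : Nat.card (W.selmerGroup 2) = 2)
    (K : Type) [Field K] [NumberField K] (hK : IsImaginaryQuadratic K)
    (hodd : Odd (NumberField.discr K)) (h3 : NumberField.discr K ≠ -3) (hH : SatisfiesHeegnerHypothesis (W.conductorNorm ℤ) K)
    (_h2K : ((Ideal.span {(2 : ℤ)}).primesOver (𝓞 K)).ncard = 2)
    (Wd : WeierstrassCurve ℚ) [Wd.IsElliptic] [Wd.IsGloballyMinimal]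
    (hWd : ∃ C : VariableChange ℚ, C • W.quadraticTwist (NumberField.discr K : ℚ) = Wd)
    (_hLv : (W.quadraticTwist (NumberField.discr K : ℚ)).entireLFunction 1 ≠ 0)
    (Dt : ModularParametrizationData W (W.conductorNorm ℤ)) (β : ℤ) (ι : K →+* ℂ) (d₁ : KolyvaginHeegnerData Dt β ι 1) (M₀ : ℕ)
    (_hdiv : ∃ Q : (W.baseChange (ringClassField K ι 1)).toAffine.Point, ((2 ^ M₀ : ℕ) : ℤ) • Q = d₁.derivedPoint)
    (hndiv : ¬ ∃ Q : (W.baseChange (ringClassField K ι 1)).toAffine.Point, ((2 ^ (M₀ + 1) : ℕ) : ℤ) • Q = d₁.derivedPoint)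
    -- the cut
    (hT : Odd W.tamagawaProduct) (v : HeightOneSpectrum (𝓞 ℚ)) (h2v : ((2 : ℕ) : 𝓞 ℚ) ∉ v.asIdeal)
    (hNv : ((W.conductorNorm ℤ : ℕ) : 𝓞 ℚ) ∈ v.asIdeal) (hmult : W.HasMultiplicativeReductionAt v)
    (hρ : ∀ n : ℕ, 0 < n → W.HasSurjectiveModNGaloisRep ((2 : ℤ) ^ n))
    (hw : W.rootNumber = -1) (hc : Odd Dt.c)
    (hbudget : (W.Δ < 0 ∧ padicValNat 2 Wd.tamagawaProduct ≤ 1) ∨ padicValNat 2 Wd.tamagawaProduct = 0) :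
    Nat.card (AddCommGroup.primaryComponent (W.baseChange K).sha 2) *
        2 ^ (2 * (padicValInt 2 Dt.c + padicValNat 2 W.tamagawaProduct)) ∣ 2 ^ (2 * M₀) := by
  haveI : Fact (Nat.Prime 2) := ⟨Nat.prime_two⟩
  have hc2 : padicValInt 2 Dt.c = 0 :=
    padicValInt.eq_zero_of_not_dvd fun h ↦ (Int.not_even_iff_odd.mpr hc) (even_iff_two_dvd.mpr (by exact_mod_cast h))
  have hC2 : padicValNat 2 W.tamagawaProduct = 0 :=
    padicValNat.eq_zero_of_not_dvd fun h ↦ (Nat.not_even_iff_odd.mpr hT) (even_iff_two_dvd.mpr h)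
  rw [hc2, hC2, add_zero, mul_zero, pow_zero, mul_one]
  obtain ⟨hsq1, hsq2⟩ := kolyvaginExclusions_of_odd_of_satisfiesHeegnerHypothesis W hK hodd hH
  have hrk : 1 ≤ W.mordellWeilRank := by
    rw [(hGZK W (le_of_eq hr)).1, hr]
  obtain ⟨Cd, hCd⟩ := hWd
  exact (finite_and_natCard_primaryComponent_sha_baseChange_two_dvd_pow_of_swappedPair_signFree hQ2 W hcm hT v h2v hNv hmult K hK hodd h3 hH
    hsq1 hsq2 hρ Dt β ι d₁ M₀ hndiv hw hrk hSel Cd hCd hbudget).2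

/-! ## §4 All-silent frames on `Δ > 0`: the budget is `0` -/

/-- **DIV′ ON THE ODD CUT AT EVERY ALL-SILENT HEEGNER FRAME** (`W(ℚ_q)[2] = 0` for every prime `q ∣ d_K`; e.g. a prime frame `d_K = −ℓ₀` with the
`2`-division cubic irreducible mod `ℓ₀`): then `ord₂ C(Wd) = 0` (gk2-p3 g27 `padicValNat_two_tamagawaProduct_twin_eq_zero_of_forall_silent`), so §3
applies with no further budget hypothesis: **`#Ш(W_K)[2^∞] · 2^{2(ord₂ c + ord₂ C(W))} ∣ 2^{2M₀}`**, modulo Q2 and GZK.  On `Δ > 0` these are exactly the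
frames consumed by the `Δ > 0` halves of the route (silent twins); on `Δ < 0` the hypothesis is never met (genus parity).  CONDITIONAL on Q2 and GZK;
closes nothing; BSD is NOT proved.  [cite: Kolyvagin1989Izv, Thm. B_l] [cite: Kramer1981, §2 Prop. 3] [cite: MazurRubin2010, Cor. 3.4 (i)] -/
theorem heegnerIndexUpper_conclusion_onOddCut_allSilent (hQ2 : KolyvaginRelationAtTwo) (hGZK : rank_eq_analyticRank_of_analyticRank_le_one)
    (W : WeierstrassCurve ℚ) [W.IsElliptic] [W.IsGloballyMinimal] [NeZero (W.conductorNorm ℤ)]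
    (hcm : ¬ W.HasCM) (hr : W.analyticRank = 1) (hSel : Nat.card (W.selmerGroup 2) = 2)
    (K : Type) [Field K] [NumberField K] (hK : IsImaginaryQuadratic K)
    (hodd : Odd (NumberField.discr K)) (h3 : NumberField.discr K ≠ -3) (hH : SatisfiesHeegnerHypothesis (W.conductorNorm ℤ) K)
    (hsil : ∀ (p : ℕ) [Fact p.Prime], (p : ℤ) ∣ NumberField.discr K → ∀ Q : (W.baseChange ℚ_[p]).toAffine.Point, 2 • Q = 0 → Q = 0)
    (Wd : WeierstrassCurve ℚ) [Wd.IsElliptic] [Wd.IsGloballyMinimal]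
    (hWd : ∃ C : VariableChange ℚ, C • W.quadraticTwist (NumberField.discr K : ℚ) = Wd)
    (Dt : ModularParametrizationData W (W.conductorNorm ℤ)) (β : ℤ) (ι : K →+* ℂ) (d₁ : KolyvaginHeegnerData Dt β ι 1) (M₀ : ℕ)
    (hndiv : ¬ ∃ Q : (W.baseChange (ringClassField K ι 1)).toAffine.Point, ((2 ^ (M₀ + 1) : ℕ) : ℤ) • Q = d₁.derivedPoint)
    -- the cut
    (hT : Odd W.tamagawaProduct) (v : HeightOneSpectrum (𝓞 ℚ)) (h2v : ((2 : ℕ) : 𝓞 ℚ) ∉ v.asIdeal)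
    (hNv : ((W.conductorNorm ℤ : ℕ) : 𝓞 ℚ) ∈ v.asIdeal) (hmult : W.HasMultiplicativeReductionAt v)
    (hρ : ∀ n : ℕ, 0 < n → W.HasSurjectiveModNGaloisRep ((2 : ℤ) ^ n))
    (hw : W.rootNumber = -1) (hc : Odd Dt.c) :
    Nat.card (AddCommGroup.primaryComponent (W.baseChange K).sha 2) *
        2 ^ (2 * (padicValInt 2 Dt.c + padicValNat 2 W.tamagawaProduct)) ∣ 2 ^ (2 * M₀) := by
  haveI : Fact (Nat.Prime 2) := ⟨Nat.prime_two⟩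
  obtain ⟨Cd, hCd⟩ := hWd
  have hDEF : padicValNat 2 Wd.tamagawaProduct = 0 :=
    padicValNat_two_tamagawaProduct_twin_eq_zero_of_forall_silent W hK hodd hH hT Cd hCd hsil
  have hc2 : padicValInt 2 Dt.c = 0 :=
    padicValInt.eq_zero_of_not_dvd fun h ↦ (Int.not_even_iff_odd.mpr hc) (even_iff_two_dvd.mpr (by exact_mod_cast h))
  have hC2 : padicValNat 2 W.tamagawaProduct = 0 :=
    padicValNat.eq_zero_of_not_dvd fun h ↦ (Nat.not_even_iff_odd.mpr hT) (even_iff_two_dvd.mpr h)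
  rw [hc2, hC2, add_zero, mul_zero, pow_zero, mul_one]
  obtain ⟨hsq1, hsq2⟩ := kolyvaginExclusions_of_odd_of_satisfiesHeegnerHypothesis W hK hodd hH
  have hrk : 1 ≤ W.mordellWeilRank := by
    rw [(hGZK W (le_of_eq hr)).1, hr]
  exact (finite_and_natCard_primaryComponent_sha_baseChange_two_dvd_pow_of_swappedPair_signFree hQ2 W hcm hT v h2v hNv hmult K hK hodd h3 hH
    hsq1 hsq2 hρ Dt β ι d₁ M₀ hndiv hw hrk hSel Cd hCd (Or.inr hDEF)).2

end Summit.BirchSwinnertonDyer.BirchSwinnertonDyer.Theorems.GenusExact.TwinSwap.TwinAnnihilation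

end
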